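import Summits.HodgeConjecture.HodgeConjecture.Theorems.R90S6GLCartanBasisExpansion   -- ★ (H.1-gen) `eq_sum_doubleCosetCoeff_smul_cartan`, ★ (H.0) `doubleCosetCoeff_mul_eq_ncard` (p06)
import Summits.HodgeConjecture.HodgeConjecture.Theorems.R90S6GLPieriCountMaster       -- ★ L3 master count `ncard_pieri_eq_sum_of_antitone` (p10, all `n`, `r`)
import Literature.NumberTheory.Automorphic.SatakeParametersModP                      -- ★ `heckeDiag_mk0_eq_zpowDiagGL`, `heckeDiag_mk0_self_eq_zpowDiagGL_one`
import Literature.NumberTheory.Automorphic.HeckeDoubleCosetOperators                 -- ★ `doubleCosetOperator_central_mul` (Shimura Prop. 3.17)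
import HarnessLib

/-!
# R90 · S6 «Ch. 14.1–14.5 stable TF» — WAVE 10 card W10-j, FILE A: THE `GL₂` PIERI RULE `c_{(a,0)} · T₁ = c_{(a+1,0)} + (q + [a = 1]) · c_{(a,1)}` WITH
# EXPLICIT COUNTS (`Theorems/R90S6GLTwoPieri.lean`; row E1.4.4.3.2, `GL₂` side of «η̂ (rank 2) on the Cartan basis»)

Cell `hodgecm-mathlib`, crux H413 (`stmt-HodgeConjecture-24833`), route of record `HCCMUnconditional`; programme R90-TF, section S6 (base `R90-C14`),
seat R90-C14-p02 (g2); S6 dealer R90-C14-plan (g2) CARD W10-j (R90 bus 2026-09-05T01:37:25Z), (J.2) «GL₂ PIERI r = 1 BY NAME from p10's ★ generic master».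
Lane `--supports stmt-HodgeConjecture-24833 --as helper`; THEOREMS ONLY; any `CommRing k`; letters = ★ p06 ∕ p10 (`K` a discretely valued field, `hϖ`,
`c_ν = heckeAlgebra.doubleCosetOperator (glInt 2 K) (zpowDiagGL hϖ.ne_zero ν)`, `T_r = … (heckeDiag 2 ϖ r)`, `q = Nat.card 𝓀[K]`).

CONTENT (the `n = 2` instance of ★ W10-f (p06, `n = 3`) with the counts EVALUATED from ★ L3 (p10)):
* §1 letters: (P.0) `c_{ν+𝟙} = T₂ · c_ν` (central shift), `c_0 = 1`, `T₁ = c_{(1,0)}`;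
* §2 (P.c) THE `n = 2`, `r = 1` COUNT: for `μ = (a, 0)` (`a ≥ 1`) and antitone `λ`,
  `#{γ ∈ K₀·(t₁K₀) : (γ.out⁻¹ϖ^λ)K₀ ∈ K₀·(ϖ^μK₀)} = [λ = (a+1,0)]·1 + [λ = (a,1)]·(q + [a = 1])`
  (★ `ncard_pieri_eq_sum_of_antitone` at `n = 2`: pivot sets `S ∈ {{0},{1}}`, `c({0}) = 0`, `c({1}) = 1`; `Perm(Fin 2) = {1, swap}`);
* §3 (P.1) **`doubleCosetOperator_zpowDiagGL_mul_heckeDiag_one_two`**: `c_{(a,0)} · T₁ = c_{(a+1,0)} + ((q + [a = 1] : ℕ) : k) • c_{(a,1)}` (`a ≥ 1`), with the corollaries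
  (P.1′) `a = 1`: `T₁ · T₁ = c_{(2,0)} + (q + 1) • T₂` and (P.1″) `a ≥ 2`: `c_{(a,0)} · T₁ = c_{(a+1,0)} + q • c_{(a,1)}`, `c_{(a,1)} = T₂ · c_{(a−1,0)}`.
Degree check: `(q^a + q^{a−1})(q + 1) = (q^{a+1} + q^a) + q(q^{a−1} + q^{a−2})` (`a ≥ 2`), `(q+1)² = (q² + q) + (q + 1)` (`a = 1`).
HONEST LABEL: local `GL₂` Hecke bookkeeping (classical `T_p² = T_{p²} + (p+1)R_p`); count-neutral until E1.4.4.3.2 consumes it.  HC_CM is proved only modulo the 7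
printed citations (2 remaining named inputs: hLiu418 = stmt-HodgeConjecture-24832, h413 = stmt-HodgeConjecture-24833) until rung 0 closes; REL ≠ ★ ≠ BUILT.

## References
* [Macdonald1995] I. G. Macdonald, *Symmetric Functions and Hall Polynomials*, 2nd ed. (1995), Ch. II (4.2)–(4.6), Ch. V (2.6) (`c_μ c_{(1^r)} = Σ g^λ_{μ(1^r)}(q) c_λ`).
* [ShimuraIATAF1971] G. Shimura, *Introduction to the Arithmetic Theory of Automorphic Functions* (1971), Prop. 3.17, Lemma 3.22, Thm. 3.24 (`T(p)² = T(p²) + (p+1)T(p,p)`).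
-/

set_option autoImplicit false
-- the mandated namespace repeats the single-problem summit's segment (`HodgeConjecture.HodgeConjecture`)
set_option linter.dupNamespace false

noncomputable section

open MulAction
open Literature.NumberTheory.Automorphic
open scoped MatrixGroups
open ValuativeRel

namespace Summit.HodgeConjecture.HodgeConjecture.R90.S6

universe u

/-! ## §1 Letters at `n = 2` -/

section Letters

variable {K : Type u} [Field K] [ValuativeRel K] {ϖ : K} (hϖ : IsUniformizingElement ϖ)

/-- `t₁ = diag(ϖ, 1) = ϖ^{(1,0)}`. [cite: ShimuraIATAF1971, Thm. 3.20] -/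
theorem heckeDiag_two_one_eq_zpowDiagGL : heckeDiag 2 (Units.mk0 ϖ hϖ.ne_zero) 1 = zpowDiagGL hϖ.ne_zero ![(1 : ℤ), 0] := by
  rw [heckeDiag_mk0_eq_zpowDiagGL]
  congr 1
  funext i
  fin_cases i <;> rfl

/-- `t₂ = ϖ·1₂ = ϖ^{(1,1)} = ϖ^{𝟙}`. [cite: ShimuraIATAF1971, Thm. 3.20] -/
theorem heckeDiag_two_two_eq_zpowDiagGL : heckeDiag 2 (Units.mk0 ϖ hϖ.ne_zero) 2 = zpowDiagGL hϖ.ne_zero (1 : Fin 2 → ℤ) :=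
  heckeDiag_mk0_self_eq_zpowDiagGL_one hϖ.ne_zero

variable [IsHeckeTriple (⊤ : Submonoid (GL (Fin 2) K)) (glInt 2 K) (glInt 2 K)] {k : Type*} [CommRing k]

/-- **(P.0) CENTRAL SHIFT `c_{ν + 𝟙} = T₂ · c_ν`** (`T₂ = 1_{K₀ ϖ K₀}`, `ϖ 1₂` central). [cite: ShimuraIATAF1971, Prop. 3.17] [cite: Macdonald1995, Ch. V (2.5)] -/
theorem doubleCosetOperator_zpowDiagGL_add_one_two (ν : Fin 2 → ℤ) :
    heckeAlgebra.doubleCosetOperator (k := k) (glInt 2 K) (zpowDiagGL hϖ.ne_zero (ν + 1)) =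
      heckeAlgebra.doubleCosetOperator (glInt 2 K) (heckeDiag 2 (Units.mk0 ϖ hϖ.ne_zero) 2) *
        heckeAlgebra.doubleCosetOperator (glInt 2 K) (zpowDiagGL hϖ.ne_zero ν) := by
  rw [heckeDiag_mk0_self_eq_zpowDiagGL_one, heckeAlgebra.doubleCosetOperator_central_mul (glInt 2 K)
    (fun x => mul_zpowDiagGL_const_comm hϖ.ne_zero (1 : ℤ) x), ← zpowDiagGL_add]
  congr 2
  funext i
  simp only [Pi.add_apply, Pi.one_apply, add_comm]

/-- `c_0 = 1`. [cite: Macdonald1995, Ch. V (2.6)] -/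
theorem doubleCosetOperator_zpowDiagGL_zero_two :
    heckeAlgebra.doubleCosetOperator (k := k) (glInt 2 K) (zpowDiagGL hϖ.ne_zero (0 : Fin 2 → ℤ)) = 1 := by
  rw [zpowDiagGL_zero, heckeAlgebra.doubleCosetOperator_one]

/-- `c_{(a,1)} = T₂ · c_{(a−1,0)}` (`a ≥ 1`). [cite: ShimuraIATAF1971, Prop. 3.17] -/
theorem doubleCosetOperator_zpowDiagGL_pair_one_two {a : ℕ} (ha : 1 ≤ a) :
    heckeAlgebra.doubleCosetOperator (k := k) (glInt 2 K) (zpowDiagGL hϖ.ne_zero ![(a : ℤ), 1]) =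
      heckeAlgebra.doubleCosetOperator (glInt 2 K) (heckeDiag 2 (Units.mk0 ϖ hϖ.ne_zero) 2) *
        heckeAlgebra.doubleCosetOperator (glInt 2 K) (zpowDiagGL hϖ.ne_zero ![((a - 1 : ℕ) : ℤ), 0]) := by
  rw [← doubleCosetOperator_zpowDiagGL_add_one_two hϖ]
  congr 2
  funext i
  fin_cases i
  · simp only [Fin.zero_eta, Fin.isValue, Matrix.cons_val_zero, Pi.add_apply, Pi.one_apply, Nat.cast_sub ha, Nat.cast_one, sub_add_cancel]
  · simp

end Letters

/-! ## §2 (P.c) The `n = 2`, `r = 1` neighbour count -/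

section Count

variable {K : Type u} [Field K] [ValuativeRel K] [IsDiscreteValuationRing 𝒪[K]] [Finite 𝓀[K]] {ϖ : K} (hϖ : IsUniformizingElement ϖ)

/-- `Perm(Fin 2) = {1, swap 0 1}`. [folklore] -/
private theorem perm_fin_two_eq (σ : Equiv.Perm (Fin 2)) : σ = 1 ∨ σ = Equiv.swap 0 1 := by
  revert σ
  decide

/-- The pivot sets at `n = 2`, `r = 1`: `{S ⊆ Fin 2 : #S = 1} = {{0}, {1}}`. [folklore] -/
private theorem filter_card_eq_one_fin_two :
    (Finset.univ : Finset (Finset (Fin 2))).filter (fun S => S.card = 2 - 1) = {{0}, {1}} := by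
  decide

/-- `c({0}) = 0`: no echelon position for the pivot set `{0}`. [folklore] -/
private theorem card_echelonPositions_zero_fin_two : (echelonPositions ({0} : Finset (Fin 2))).card = 0 := by
  decide

/-- `c({1}) = 1`: the single echelon position `(0,1)` for the pivot set `{1}`. [folklore] -/
private theorem card_echelonPositions_one_fin_two : (echelonPositions ({1} : Finset (Fin 2))).card = 1 := by
  decide

/-- A function on `Fin 2` is the vector of its two values. [folklore] -/
private theorem eq_vecCons_iff (f : Fin 2 → ℤ) (x y : ℤ) : f = ![x, y] ↔ f 0 = x ∧ f 1 = y := by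
  constructor
  · rintro rfl
    exact ⟨rfl, rfl⟩
  · rintro ⟨h0, h1⟩
    funext i
    fin_cases i
    · exact h0
    · exact h1

/-- **(P.c) THE `n = 2`, `r = 1` PIERI COUNT**: for `μ = (a, 0)` (`a ≥ 1`) and antitone `λ`, the number of `1`-neighbours of `𝒪²` in position `μ` relative to `ϖ^λ𝒪²` is
`1` if `λ = (a+1, 0)`, `q + [a = 1]` if `λ = (a, 1)`, and `0` otherwise (★ L3 `ncard_pieri_eq_sum_of_antitone` at `n = 2`: `S = {0}` contributes `q⁰ = 1` exactly when
`(λ₁, λ₀ − 1)` is a permutation of `(a, 0)`, `S = {1}` contributes `q¹` exactly when `(λ₁ − 1, λ₀)` is). [cite: Macdonald1995, Ch. II (4.6), Ch. V (2.6)]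
[cite: ShimuraIATAF1971, Lemma 3.22] -/
theorem ncard_pieri_two_one {a : ℕ} (ha : 1 ≤ a) {lam : Fin 2 → ℤ} (hlam : Antitone lam) :
    {γ ∈ MulAction.orbit (glInt 2 K) (((heckeDiag 2 (Units.mk0 ϖ hϖ.ne_zero) 1 : GL (Fin 2) K)) : GL (Fin 2) K ⧸ glInt 2 K) |
        ((((γ.out)⁻¹ * zpowDiagGL hϖ.ne_zero lam : GL (Fin 2) K)) : GL (Fin 2) K ⧸ glInt 2 K) ∈
          MulAction.orbit (glInt 2 K) (((zpowDiagGL hϖ.ne_zero ![(a : ℤ), 0] : GL (Fin 2) K)) : GL (Fin 2) K ⧸ glInt 2 K)}.ncard =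
      if lam = ![(a : ℤ) + 1, 0] then 1 else if lam = ![(a : ℤ), 1] then Nat.card 𝓀[K] + (if a = 1 then 1 else 0) else 0 := by
  have h10 := hlam (show (0 : Fin 2) ≤ 1 by decide)   -- `λ₁ ≤ λ₀`
  rw [ncard_pieri_eq_sum_of_antitone hϖ (r := 1) (by norm_num) hlam, filter_card_eq_one_fin_two, Finset.sum_pair (by decide),
    card_echelonPositions_zero_fin_two, card_echelonPositions_one_fin_two, pow_zero, pow_one]
  -- the two permutation conditions, made explicit
  have hex : ∀ S : Finset (Fin 2), (∃ σ : Equiv.Perm (Fin 2), ∀ i, (![(a : ℤ), 0] : Fin 2 → ℤ) (σ i) = lam (Fin.rev i) - (epsOf S i : ℤ)) ↔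
      ((a : ℤ) = lam 1 - (epsOf S 0 : ℤ) ∧ (0 : ℤ) = lam 0 - (epsOf S 1 : ℤ)) ∨
        ((0 : ℤ) = lam 1 - (epsOf S 0 : ℤ) ∧ (a : ℤ) = lam 0 - (epsOf S 1 : ℤ)) := fun S => by
    constructor
    · rintro ⟨σ, hσ⟩
      rcases perm_fin_two_eq σ with rfl | rfl
      · exact Or.inl ⟨by simpa using hσ 0, by simpa using hσ 1⟩
      · exact Or.inr ⟨by simpa using hσ 0, by simpa using hσ 1⟩
    · rintro (⟨h0, h1⟩ | ⟨h0, h1⟩)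
      · exact ⟨1, fun i => by fin_cases i <;> simpa⟩
      · exact ⟨Equiv.swap 0 1, fun i => by fin_cases i <;> simpa⟩
  have e00 : (epsOf ({0} : Finset (Fin 2)) 0 : ℤ) = 0 := by simp [epsOf]
  have e01 : (epsOf ({0} : Finset (Fin 2)) 1 : ℤ) = 1 := by simp [epsOf]
  have e10 : (epsOf ({1} : Finset (Fin 2)) 0 : ℤ) = 1 := by simp [epsOf]
  have e11 : (epsOf ({1} : Finset (Fin 2)) 1 : ℤ) = 0 := by simp [epsOf]
  simp only [hex, e00, e01, e10, e11, sub_zero, eq_vecCons_iff]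
  split_ifs <;> omega

end Count

/-! ## §3 (P.1) The Pieri rule `c_{(a,0)} · T₁` -/

section Pieri

variable {K : Type u} [Field K] [ValuativeRel K] [IsDiscreteValuationRing 𝒪[K]] [Finite 𝓀[K]] {ϖ : K} (hϖ : IsUniformizingElement ϖ)
  [IsHeckeTriple (⊤ : Submonoid (GL (Fin 2) K)) (glInt 2 K) (glInt 2 K)] {k : Type*} [CommRing k]

/-- **(P.1) THE `GL₂` PIERI RULE `c_{(a,0)} · T₁ = c_{(a+1,0)} + (q + [a = 1]) • c_{(a,1)}`** (`a ≥ 1`, any `CommRing k`): the coordinates of `c_{(a,0)} · T₁` in the Cartan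
basis are the neighbour counts (★ (H.0) `doubleCosetCoeff_mul_eq_ncard`), evaluated by (P.c), assembled by ★ (H.1-gen) `eq_sum_doubleCosetCoeff_smul_cartan`.
[cite: Macdonald1995, Ch. II (4.6), Ch. V (2.6)] [cite: ShimuraIATAF1971, Lemma 3.22, Thm. 3.24] -/
theorem doubleCosetOperator_zpowDiagGL_mul_heckeDiag_one_two {a : ℕ} (ha : 1 ≤ a) :
    heckeAlgebra.doubleCosetOperator (k := k) (glInt 2 K) (zpowDiagGL hϖ.ne_zero ![(a : ℤ), 0]) *
        heckeAlgebra.doubleCosetOperator (glInt 2 K) (heckeDiag 2 (Units.mk0 ϖ hϖ.ne_zero) 1) =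
      heckeAlgebra.doubleCosetOperator (glInt 2 K) (zpowDiagGL hϖ.ne_zero ![(a : ℤ) + 1, 0]) +
        ((Nat.card 𝓀[K] + (if a = 1 then 1 else 0) : ℕ) : k) • heckeAlgebra.doubleCosetOperator (glInt 2 K) (zpowDiagGL hϖ.ne_zero ![(a : ℤ), 1]) := by
  classical
  set T := heckeAlgebra.doubleCosetOperator (k := k) (glInt 2 K) (zpowDiagGL hϖ.ne_zero ![(a : ℤ), 0]) *
    heckeAlgebra.doubleCosetOperator (glInt 2 K) (heckeDiag 2 (Units.mk0 ϖ hϖ.ne_zero) 1) with hT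
  -- (H.0) + (P.c): the coordinates of `c_{(a,0)} · T₁`
  have hcoef : ∀ ν : Fin 2 → ℤ, Antitone ν → heckeAlgebra.doubleCosetCoeff (glInt 2 K) T
      (HeckeCoset.mk (glInt 2 K) (glInt 2 K) ⟨zpowDiagGL hϖ.ne_zero ν, Submonoid.mem_top _⟩) =
      ((if ν = ![(a : ℤ) + 1, 0] then 1 else if ν = ![(a : ℤ), 1] then Nat.card 𝓀[K] + (if a = 1 then 1 else 0) else 0 : ℕ) : k) := fun ν hν => by
    rw [hT, doubleCosetCoeff_mul_eq_ncard, ncard_pieri_two_one hϖ ha hν]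
  have hne : (![(a : ℤ) + 1, 0] : Fin 2 → ℤ) ≠ ![(a : ℤ), 1] := fun h => by
    have h1 := congr_fun h 1
    simp at h1
  have hA : Antitone (![(a : ℤ) + 1, 0] : Fin 2 → ℤ) := Fin.antitone_iff_succ_le.2 fun i => by
    fin_cases i
    simp only [Fin.zero_eta, Fin.isValue, Fin.succ_zero_eq_one, Matrix.cons_val_one, Matrix.cons_val_fin_one, Fin.castSucc_zero,
      Matrix.cons_val_zero]
    positivity
  have hB : Antitone (![(a : ℤ), 1] : Fin 2 → ℤ) := Fin.antitone_iff_succ_le.2 fun i => by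
    fin_cases i
    simp only [Fin.zero_eta, Fin.isValue, Fin.succ_zero_eq_one, Matrix.cons_val_one, Matrix.cons_val_fin_one, Fin.castSucc_zero,
      Matrix.cons_val_zero]
    exact_mod_cast ha
  have hsupp : ∀ ν : Fin 2 → ℤ, Antitone ν → heckeAlgebra.doubleCosetCoeff (glInt 2 K) T
      (HeckeCoset.mk (glInt 2 K) (glInt 2 K) ⟨zpowDiagGL hϖ.ne_zero ν, Submonoid.mem_top _⟩) ≠ 0 →
      ν ∈ ({![(a : ℤ) + 1, 0], ![(a : ℤ), 1]} : Finset (Fin 2 → ℤ)) := fun ν hν h => by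
    rw [hcoef ν hν] at h
    rw [Finset.mem_insert, Finset.mem_singleton]
    by_contra hn
    rw [not_or] at hn
    exact h (by rw [if_neg hn.1, if_neg hn.2, Nat.cast_zero])
  refine (eq_sum_doubleCosetCoeff_smul_cartan hϖ T {![(a : ℤ) + 1, 0], ![(a : ℤ), 1]}
    (fun ν hν => by
      rcases Finset.mem_insert.1 hν with rfl | hν
      · exact hA
      · rw [Finset.mem_singleton.1 hν]; exact hB) hsupp).trans ?_
  rw [Finset.sum_pair hne, hcoef _ hA, hcoef _ hB, if_pos rfl, if_neg hne.symm, if_pos rfl, Nat.cast_one, one_smul]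

/-- **(P.1′) `a = 1`: `T₁ · T₁ = c_{(2,0)} + (q + 1) • T₂`** (classically `T(p)² = T(p²) + (p+1)T(p,p)`). [cite: ShimuraIATAF1971, Thm. 3.24] -/
theorem heckeDiag_one_mul_heckeDiag_one_two :
    heckeAlgebra.doubleCosetOperator (k := k) (glInt 2 K) (heckeDiag 2 (Units.mk0 ϖ hϖ.ne_zero) 1) *
        heckeAlgebra.doubleCosetOperator (glInt 2 K) (heckeDiag 2 (Units.mk0 ϖ hϖ.ne_zero) 1) =
      heckeAlgebra.doubleCosetOperator (glInt 2 K) (zpowDiagGL hϖ.ne_zero ![(2 : ℤ), 0]) +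
        ((Nat.card 𝓀[K] + 1 : ℕ) : k) • heckeAlgebra.doubleCosetOperator (glInt 2 K) (heckeDiag 2 (Units.mk0 ϖ hϖ.ne_zero) 2) := by
  have e : (![(1 : ℤ), 1] : Fin 2 → ℤ) = 1 := by
    funext i
    fin_cases i <;> rfl
  have h := doubleCosetOperator_zpowDiagGL_mul_heckeDiag_one_two (k := k) hϖ (a := 1) le_rfl
  rw [if_pos rfl, Nat.cast_one, show ((1 : ℤ) + 1) = 2 by norm_num, ← heckeDiag_two_one_eq_zpowDiagGL hϖ, e,
    ← heckeDiag_two_two_eq_zpowDiagGL hϖ] at h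
  exact h

/-- **(P.1″) `a ≥ 2`: `c_{(a,0)} · T₁ = c_{(a+1,0)} + q • c_{(a,1)}`.** [cite: Macdonald1995, Ch. V (2.6)] [cite: ShimuraIATAF1971, Lemma 3.22] -/
theorem doubleCosetOperator_zpowDiagGL_mul_heckeDiag_one_two_of_two_le {a : ℕ} (ha : 2 ≤ a) :
    heckeAlgebra.doubleCosetOperator (k := k) (glInt 2 K) (zpowDiagGL hϖ.ne_zero ![(a : ℤ), 0]) *
        heckeAlgebra.doubleCosetOperator (glInt 2 K) (heckeDiag 2 (Units.mk0 ϖ hϖ.ne_zero) 1) =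
      heckeAlgebra.doubleCosetOperator (glInt 2 K) (zpowDiagGL hϖ.ne_zero ![(a : ℤ) + 1, 0]) +
        ((Nat.card 𝓀[K] : ℕ) : k) • heckeAlgebra.doubleCosetOperator (glInt 2 K) (zpowDiagGL hϖ.ne_zero ![(a : ℤ), 1]) := by
  rw [doubleCosetOperator_zpowDiagGL_mul_heckeDiag_one_two hϖ (le_trans (by norm_num) ha), if_neg (by omega), add_zero]

end Pieri

end Summit.HodgeConjecture.HodgeConjecture.R90.S6

end
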